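import Summits.KontsevichZagierPeriods.KontsevichZagierPeriods.Theses.TorsionLogs
import Summits.KontsevichZagierPeriods.KontsevichZagierPeriods.Theorems.TorsionLogsNeronTorsionSector

/-!
# Witness of weakness (F3 / BC5) for the rung `NeronTorsionCoset` — line `NeronTorsionCoset`
# (crux `TorsionSectorComplete`, stmt-KontsevichZagierPeriods-14212; route `TorsionLogs`, route-KontsevichZagierPeriods-TorsionLogs)

The rung `NeronTorsionCoset` is a single ∀-statement whose members are indexed by the base abscissa `x_P ∈ [e₁, ∞)`
(hypothesis `e₁ ≤ xP`).  Its BOUNDARY MEMBER `x_P = e₁` — the statement `NeronTorsionCosetBase`, which is the rung's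
text with `xP := e₁` (`base_of_rung` = literal instantiation) — IS THE FLOOR: the base point is the 2-torsion corner
`T₁ = (e₁,0)`, the translate `R = T₁ + T` is the floor's torsion point `S` (`base_translate_eq`: the chord formula at
`x_P = e₁` returns `x_S`, using `f e₁ = 0`), the Néron triangle `rI(T₁)` has EMPTY domain (null move, value `0`) and
the η-carrier `rU(T₁)` has the domain and integrand of `rP` (congruent pair), so the tied coset element collapses to
the floor's `q²•[rI(S)] + p²•[rP] − c•[rB]`; the seed theorem
`Cruxes.NeronTorsionSector.Translation.stub_assembly : NeronTorsionPrimitiveChain` (item stmt-KontsevichZagierPeriods-17981,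
seed g1-KontsevichZagierPeriods-17981, PROVED) closes it after soundness + the landed interval-log carrier swap
(`base_of_floor`, which CONSUMES the floor; `cosetBase := base_of_floor stub_assembly`, no sorry).
For `x_P > e₁` the element carries the η-carrier `(pq)•[rU(P)]` of transcendental value `η₁u_P` at a NON-torsion
point and the difference of two Néron triangles at non-torsion points — the floor's proof (corner slice
`asmS2_corner`, corner fold `asmX_fold`, reflection symmetry `stub_periodSymmetry` of the grid `X(kω₁/n)`) does not
run: tribunal forward kernel `floor → rung` open, `real_step=true`.
witness_regime: real Weierstrass models over `ℚ̄ ∩ ℝ` with a real torsion point on the identity component and a free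
real algebraic base point; Conjecture 1 (the sub-problem statement) is NOT known for this family in any regime — the
value identity realised is quadratic in 1-periods and involves the Néron local height at a non-torsion point,
outside the proved linear theory of 1-periods (Huber–Wüstholz 2022, Thm 9.10; Rem 13.2(3)).
Self-contained: verbatim copies of the `def`s and bookkeeping lemmas of `Lines/NeronTorsionCoset.lean` in the
namespace `…NeronTorsionCoset.Special` (the skeleton module carries the same witness `cosetBase` about the registered
decls).
-/

namespace Summit.KontsevichZagierPeriods.KontsevichZagierPeriods.Cruxes.TorsionSectorComplete.NeronTorsionCoset.Special

open Set MeasureTheory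
open Literature.NumberTheory.Transcendental
open Summit.KontsevichZagierPeriods.KontsevichZagierPeriods.Theses.TorsionLogs (NeronTorsionPrimitiveChain)
open Summit.KontsevichZagierPeriods.KontsevichZagierPeriods.Cruxes.NeronTorsionSector.Translation (stub_assembly
  logRep_value isAlgebraic_of_logRep)
open Summit.KontsevichZagierPeriods.HyperbolicBloch.OffTetraSectorKernel (interval_log_relation_mem_relations)

-- `Summit.KontsevichZagierPeriods.KontsevichZagierPeriods.…` is the tree's mandated layout (single-conjunct summit).
set_option linter.dupNamespace false
set_option linter.unusedVariables false

/-- The rung (verbatim copy of `Lines/NeronTorsionCoset.lean`). [cite: KontsevichZagier2001, §1.2] -/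
def NeronTorsionCoset : Prop :=
  ∀ (g₂ g₃ e₁ xS yS xT xP xR : ℝ) (N a p q : ℕ) (f : ℝ → ℝ),
    (∀ x, f x = 4 * x ^ 3 - g₂ * x - g₃) → g₂ ^ 3 - 27 * g₃ ^ 2 ≠ 0 → f e₁ = 0 → 0 < e₁ →
    (∀ x, e₁ < x → 0 < f x) → e₁ < xS → yS ^ 2 = f xS → 3 ≤ N → 0 < a → 2 * a < N →
    (∀ hns : (⟨0, 0, 0, -g₂ / 4, -g₃ / 4⟩ : WeierstrassCurve ℝ).toAffine.Nonsingular xS (yS / 2),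
      addOrderOf (WeierstrassCurve.Affine.Point.some xS (yS / 2) hns) = N) →
    (N : ℝ) * (∫ x in Set.Ioi xS, (Real.sqrt (f x))⁻¹) = a * (2 * ∫ x in Set.Ioi e₁, (Real.sqrt (f x))⁻¹) →
    Nat.Coprime p q → (q : ℤ) * ((N : ℤ) - 2 * (a : ℤ)) = (p : ℤ) * (2 * (N : ℤ)) →
    e₁ < xT → (xT - e₁) * (xS - e₁) = 3 * e₁ ^ 2 - g₂ / 4 →
    e₁ ≤ xP → xP ≠ xT →
    xR = (Real.sqrt (f xP) - Real.sqrt (f xT)) ^ 2 / (4 * (xP - xT) ^ 2) - xP - xT → e₁ < xR →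
    ∀ (rR rI rU rP : KZ.IntegralRep 2),
    rR.domain = {z | e₁ < z 1 ∧ z 1 < z 0 ∧ z 0 < xR} →
    Set.EqOn rR.integrand (fun z => z 1 / (Real.sqrt (f (z 1)) * Real.sqrt (f (z 0)))) rR.domain →
    rI.domain = {z | e₁ < z 1 ∧ z 1 < z 0 ∧ z 0 < xP} →
    Set.EqOn rI.integrand (fun z => z 1 / (Real.sqrt (f (z 1)) * Real.sqrt (f (z 0)))) rI.domain →
    rU.domain = {z | xP < z 0 ∧ e₁ < z 1} →
    Set.EqOn rU.integrand
      (fun z => (Real.sqrt (f (z 0)))⁻¹ * ((g₂ * z 1 + 2 * g₃) / (2 * (z 1) ^ 2 * Real.sqrt (f (z 1))))) rU.domain →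
    rP.domain = {z | e₁ < z 0 ∧ e₁ < z 1} →
    Set.EqOn rP.integrand
      (fun z => (Real.sqrt (f (z 0)))⁻¹ * ((g₂ * z 1 + 2 * g₃) / (2 * (z 1) ^ 2 * Real.sqrt (f (z 1))))) rP.domain →
    ∀ (c : ℤ) (B : ℝ) (rB : KZ.IntegralRep 1), 1 < B → rB.domain = {t | 1 < t 0 ∧ t 0 < B} →
    Set.EqOn rB.integrand (fun t => (t 0)⁻¹) rB.domain →
    (q : ℝ) ^ 2 * rR.value - (q : ℝ) ^ 2 * rI.value + (p : ℝ) * q * rU.value + ((p : ℝ) ^ 2 - p * q) * rP.value = c * rB.value →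
    ((q : ℤ) ^ 2) • KZ.of rR - ((q : ℤ) ^ 2) • KZ.of rI + ((p : ℤ) * q) • KZ.of rU +
        ((p : ℤ) ^ 2 - p * q) • KZ.of rP - c • KZ.of rB ∈ KZ.relations

/-- Its boundary member `x_P = e₁` (verbatim copy). [cite: KontsevichZagier2001, §1.2] -/
def NeronTorsionCosetBase : Prop :=
  ∀ (g₂ g₃ e₁ xS yS xT xR : ℝ) (N a p q : ℕ) (f : ℝ → ℝ),
    (∀ x, f x = 4 * x ^ 3 - g₂ * x - g₃) → g₂ ^ 3 - 27 * g₃ ^ 2 ≠ 0 → f e₁ = 0 → 0 < e₁ →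
    (∀ x, e₁ < x → 0 < f x) → e₁ < xS → yS ^ 2 = f xS → 3 ≤ N → 0 < a → 2 * a < N →
    (∀ hns : (⟨0, 0, 0, -g₂ / 4, -g₃ / 4⟩ : WeierstrassCurve ℝ).toAffine.Nonsingular xS (yS / 2),
      addOrderOf (WeierstrassCurve.Affine.Point.some xS (yS / 2) hns) = N) →
    (N : ℝ) * (∫ x in Set.Ioi xS, (Real.sqrt (f x))⁻¹) = a * (2 * ∫ x in Set.Ioi e₁, (Real.sqrt (f x))⁻¹) →
    Nat.Coprime p q → (q : ℤ) * ((N : ℤ) - 2 * (a : ℤ)) = (p : ℤ) * (2 * (N : ℤ)) →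
    e₁ < xT → (xT - e₁) * (xS - e₁) = 3 * e₁ ^ 2 - g₂ / 4 →
    e₁ ≤ e₁ → e₁ ≠ xT →
    xR = (Real.sqrt (f e₁) - Real.sqrt (f xT)) ^ 2 / (4 * (e₁ - xT) ^ 2) - e₁ - xT → e₁ < xR →
    ∀ (rR rI rU rP : KZ.IntegralRep 2),
    rR.domain = {z | e₁ < z 1 ∧ z 1 < z 0 ∧ z 0 < xR} →
    Set.EqOn rR.integrand (fun z => z 1 / (Real.sqrt (f (z 1)) * Real.sqrt (f (z 0)))) rR.domain →
    rI.domain = {z | e₁ < z 1 ∧ z 1 < z 0 ∧ z 0 < e₁} →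
    Set.EqOn rI.integrand (fun z => z 1 / (Real.sqrt (f (z 1)) * Real.sqrt (f (z 0)))) rI.domain →
    rU.domain = {z | e₁ < z 0 ∧ e₁ < z 1} →
    Set.EqOn rU.integrand
      (fun z => (Real.sqrt (f (z 0)))⁻¹ * ((g₂ * z 1 + 2 * g₃) / (2 * (z 1) ^ 2 * Real.sqrt (f (z 1))))) rU.domain →
    rP.domain = {z | e₁ < z 0 ∧ e₁ < z 1} →
    Set.EqOn rP.integrand
      (fun z => (Real.sqrt (f (z 0)))⁻¹ * ((g₂ * z 1 + 2 * g₃) / (2 * (z 1) ^ 2 * Real.sqrt (f (z 1))))) rP.domain →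
    ∀ (c : ℤ) (B : ℝ) (rB : KZ.IntegralRep 1), 1 < B → rB.domain = {t | 1 < t 0 ∧ t 0 < B} →
    Set.EqOn rB.integrand (fun t => (t 0)⁻¹) rB.domain →
    (q : ℝ) ^ 2 * rR.value - (q : ℝ) ^ 2 * rI.value + (p : ℝ) * q * rU.value + ((p : ℝ) ^ 2 - p * q) * rP.value = c * rB.value →
    ((q : ℤ) ^ 2) • KZ.of rR - ((q : ℤ) ^ 2) • KZ.of rI + ((p : ℤ) * q) • KZ.of rU +
        ((p : ℤ) ^ 2 - p * q) • KZ.of rP - c • KZ.of rB ∈ KZ.relations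

/-- Interval-log calculus with two carriers: `c₀·log B₀ = c·log B` between logs of real algebraic numbers `> 1` gives
`c₀•[rB₀] − c•[rB] ∈ relations` (landed `interval_log_relation_mem_relations`). [cite: KontsevichZagier2001, §1.1] -/
theorem carrier_swap {c₀ c : ℤ} {B₀ B : ℝ} (rB₀ rB : KZ.IntegralRep 1)
    (hB₀ : 1 < B₀) (hB : 1 < B) (hB₀alg : IsAlgebraic ℚ B₀) (hBalg : IsAlgebraic ℚ B)
    (hd₀ : rB₀.domain = {t | 1 < t 0 ∧ t 0 < B₀}) (hi₀ : Set.EqOn rB₀.integrand (fun t => (t 0)⁻¹) rB₀.domain)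
    (hd : rB.domain = {t | 1 < t 0 ∧ t 0 < B}) (hi : Set.EqOn rB.integrand (fun t => (t 0)⁻¹) rB.domain)
    (hlog : (c₀ : ℝ) * Real.log B₀ - c * Real.log B = 0) :
    c₀ • KZ.of rB₀ - c • KZ.of rB ∈ KZ.relations := by
  have hi₀1 : Set.EqOn rB₀.integrand (fun t : Fin 1 → ℝ => 1 / t 0) rB₀.domain := fun t ht => by
    simp only [hi₀ ht, one_div]
  have hi1 : Set.EqOn rB.integrand (fun t : Fin 1 → ℝ => 1 / t 0) rB.domain := fun t ht => by
    simp only [hi ht, one_div]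
  have h := interval_log_relation_mem_relations 2 ![1, 1] ![B₀, B] ![c₀, -c] ![rB₀, rB]
    (fun i => by fin_cases i <;> simp)
    (fun i => by fin_cases i <;> simp [hB₀.le, hB.le])
    (fun i => by fin_cases i <;> exact isAlgebraic_one)
    (fun i => by fin_cases i <;> simp [hB₀alg, hBalg])
    (fun i => by
      fin_cases i
      · exact ⟨hd₀, hi₀1⟩
      · exact ⟨hd, hi1⟩)
    (by
      simp only [Fin.sum_univ_two, Matrix.cons_val_zero, Matrix.cons_val_one, div_one, Int.cast_neg]
      linear_combination hlog)
  have e : ∑ i : Fin 2, (![c₀, -c] i : ℤ) • KZ.of (![rB₀, rB] i) = c₀ • KZ.of rB₀ - c • KZ.of rB := by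
    simp only [Fin.sum_univ_two, Matrix.cons_val_zero, Matrix.cons_val_one, neg_smul]
    abel
  rw [e] at h
  exact h

/-- A Néron "triangle" `{e < z 1 < z 0 < e}` is EMPTY: its representation is a relation (null move) and has value
`0`. [folklore] -/
theorem emptyTriangle (r : KZ.IntegralRep 2) {e : ℝ} (hd : r.domain = {z | e < z 1 ∧ z 1 < z 0 ∧ z 0 < e}) :
    KZ.of r ∈ KZ.relations ∧ r.value = 0 := by
  have hempty : r.domain = ∅ := by
    rw [hd]
    ext z
    simp only [Set.mem_setOf_eq, Set.mem_empty_iff_false, iff_false, not_and]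
    intro h1 h2 h3
    linarith
  refine ⟨KZ.of_mem_relations_of_volume_eq_zero r (by rw [hempty, measure_empty]), ?_⟩
  show ∫ x in r.domain, r.integrand x = 0
  rw [hempty, Measure.restrict_empty, integral_zero_measure]

/-- Two representations with the same domain whose integrands agree with one function on it: their difference is a
relation (integrand congruence) and their values agree. [folklore] -/
theorem congr_pair {n : ℕ} (r r' : KZ.IntegralRep n) {F : (Fin n → ℝ) → ℝ} (hd : r.domain = r'.domain)
    (hi : Set.EqOn r.integrand F r.domain) (hi' : Set.EqOn r'.integrand F r'.domain) :
    KZ.of r - KZ.of r' ∈ KZ.relations ∧ r.value = r'.value := by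
  have hio : Set.EqOn r.integrand r'.integrand r.domain := fun z hz => by
    rw [hi hz, hi' (hd ▸ hz)]
  refine ⟨KZ.of_sub_of_mem_relations_of_eqOn hd.symm hio, ?_⟩
  show ∫ x in r.domain, r.integrand x = ∫ x in r'.domain, r'.integrand x
  rw [setIntegral_congr_fun (KZ.IntegralRep.measurableSet_domain_holds r) hio, hd]

/-- The 2-torsion translation is an involution on abscissae: at the boundary member `x_P = e₁` the chord abscissa of
`R = T₁ + T` is `x_S` (uses `f e₁ = 0`, i.e. `g₃ = 4e₁³ − g₂e₁`). [folklore] -/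
theorem base_translate_eq {g₂ g₃ e₁ xS xT xR : ℝ} {f : ℝ → ℝ} (hf : ∀ x, f x = 4 * x ^ 3 - g₂ * x - g₃)
    (he₁ : f e₁ = 0) (hTe : e₁ < xT) (hfT : 0 < f xT)
    (hT : (xT - e₁) * (xS - e₁) = 3 * e₁ ^ 2 - g₂ / 4)
    (hR : xR = (Real.sqrt (f e₁) - Real.sqrt (f xT)) ^ 2 / (4 * (e₁ - xT) ^ 2) - e₁ - xT) : xR = xS := by
  have hs0 : Real.sqrt (f e₁) = 0 := by rw [he₁, Real.sqrt_zero]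
  have hsT : Real.sqrt (f xT) ^ 2 = f xT := Real.sq_sqrt hfT.le
  have hne : xT - e₁ ≠ 0 := sub_ne_zero.mpr hTe.ne'
  have hne' : e₁ - xT ≠ 0 := sub_ne_zero.mpr hTe.ne
  have hg₃ : g₃ = 4 * e₁ ^ 3 - g₂ * e₁ := by have h := hf e₁; rw [he₁] at h; linarith
  rw [hs0, zero_sub, neg_sq, hsT, hf xT, hg₃] at hR
  have hS : xS = e₁ + (3 * e₁ ^ 2 - g₂ / 4) / (xT - e₁) := by
    rw [← hT]; field_simp; ring
  rw [hR, hS]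
  field_simp
  ring


/-! ### F3 — the boundary member is the floor -/

/-- `base_of_rung`: the boundary statement IS the rung's member `x_P = e₁` (literal instantiation). [folklore] -/
theorem base_of_rung (h : NeronTorsionCoset) : NeronTorsionCosetBase := by
  intro g₂ g₃ e₁ xS yS xT xR N a p q f hf hΔ he₁ he0 hpos hxS hyS hN ha ha2 hord htor hcop hpq hTe hT hP hPT
    hR hRe rR rI rU rP hRd hRi hId hIi hUd hUi hPd hPi
  exact h g₂ g₃ e₁ xS yS xT e₁ xR N a p q f hf hΔ he₁ he0 hpos hxS hyS hN ha ha2 hord htor hcop hpq hTe hT hP hPT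
    hR hRe rR rI rU rP hRd hRi hId hIi hUd hUi hPd hPi

/-- **`base_of_floor` (F3): the floor delivers the boundary member.**  At `x_P = e₁`: `x_R = x_S`
(`base_translate_eq`), `[rI] ∈ relations` with value `0` (empty triangle), `[rU] − [rP] ∈ relations` with equal
values (congruent pair); the floor `NeronTorsionPrimitiveChain` at the torsion datum `S` gives
`q²•[rR] + p²•[rP] − c₀•[rB₀] ∈ relations` with `B₀` algebraic, soundness evaluates it, the tie identifies
`c·log B = c₀·log B₀`, and the interval-log calculus swaps the carriers.  No sorry; the floor is used BY NAME through
`cosetBase` below. [cite: KontsevichZagier2001, §1.2] -/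
theorem base_of_floor (hfloor : NeronTorsionPrimitiveChain) : NeronTorsionCosetBase := by
  intro g₂ g₃ e₁ xS yS xT xR N a p q f hf hΔ he₁ he0 hpos hxS hyS hN ha ha2 hord htor hcop hpq hTe hT hP hPT
    hR hRe rR rI rU rP hRd hRi hId hIi hUd hUi hPd hPi c B rB hB hBd hBi hval
  -- the boundary geometry: `x_R = x_S`
  have hfT : 0 < f xT := hpos xT hTe
  have hRS : xR = xS := base_translate_eq hf he₁ hTe hfT hT hR
  -- the null triangle and the congruent carrier pair
  obtain ⟨hImem, hIval⟩ := emptyTriangle rI hId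
  obtain ⟨hUPmem, hUPval⟩ :=
    congr_pair rU rP (by rw [hUd, hPd]) hUi hPi
  -- the floor at the torsion datum `S`, with `rR` as its Néron triangle
  rw [hRS] at hRd
  obtain ⟨c₀, B₀, rB₀, hB₀, hB₀alg, hB₀d, hB₀i, hrel₀⟩ :=
    hfloor g₂ g₃ e₁ xS yS N a p q f hf hΔ he₁ he0 hpos hxS hyS hN ha ha2 hord htor hcop hpq rR rP hRd hRi hPd hPi
  -- soundness on the floor's relation; the carriers evaluate to logarithms; `B` is algebraic (semialgebraic domain)
  have hBalg : IsAlgebraic ℚ B := isAlgebraic_of_logRep hB rB hBd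
  have hB₀v : rB₀.value = Real.log B₀ := logRep_value hB₀.le rB₀ hB₀d hB₀i
  have hBv : rB.value = Real.log B := logRep_value hB.le rB hBd hBi
  have hev₀ := KZ.relations_le_ker_eval_holds hrel₀
  rw [AddMonoidHom.mem_ker] at hev₀
  simp only [map_sub, map_add, map_zsmul, KZ.eval_of, zsmul_eq_mul, Int.cast_pow, Int.cast_natCast, hB₀v] at hev₀
  rw [hIval, hUPval, hBv] at hval
  have hlog : ((c₀ : ℤ) : ℝ) * Real.log B₀ - (c : ℝ) * Real.log B = 0 := by
    linear_combination hval - hev₀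
  -- interval-log calculus: swap the floor's carrier for the given one
  have hswap := carrier_swap rB₀ rB hB₀ hB hB₀alg hBalg hB₀d hB₀i hBd hBi hlog
  -- assembly
  have e : ((q : ℤ) ^ 2) • KZ.of rR - ((q : ℤ) ^ 2) • KZ.of rI + ((p : ℤ) * q) • KZ.of rU +
        ((p : ℤ) ^ 2 - p * q) • KZ.of rP - c • KZ.of rB =
      (((q : ℤ) ^ 2) • KZ.of rR + ((p : ℤ) ^ 2) • KZ.of rP - c₀ • KZ.of rB₀) - ((q : ℤ) ^ 2) • KZ.of rI +
        ((p : ℤ) * q) • (KZ.of rU - KZ.of rP) + (c₀ • KZ.of rB₀ - c • KZ.of rB) := by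
    module
  rw [e]
  exact KZ.relations.add_mem (KZ.relations.add_mem (KZ.relations.sub_mem hrel₀ (KZ.relations.zsmul_mem hImem _))
    (KZ.relations.zsmul_mem hUPmem _)) hswap

/-- The boundary member, closed: floor BY NAME (`stub_assembly`, landed in
`Theorems/TorsionLogsNeronTorsionSectorAssemblyMain.lean`). No sorry. [cite: KontsevichZagier2001, §1.2] -/
theorem cosetBase : NeronTorsionCosetBase :=
  base_of_floor stub_assembly



/-- The instance, as an `example` naming the seed. -/
example : NeronTorsionCosetBase := base_of_floor stub_assembly

end Summit.KontsevichZagierPeriods.KontsevichZagierPeriods.Cruxes.TorsionSectorComplete.NeronTorsionCoset.Special
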